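import Literature.NumberTheory.EllipticCurves.RootNumberTwistProofs
import Literature.NumberTheory.EllipticCurves.CongruentNumberCurveAdditiveReduction
import Literature.NumberTheory.EllipticCurves.ComplexMultiplicationNotSemistable
import Literature.NumberTheory.EllipticCurves.ModularityVersionApProofs
import Literature.NumberTheory.EllipticCurves.CuspFormLFunction
import HarnessLib

set_option linter.dupNamespace false -- `Summit.BirchSwinnertonDyer.BirchSwinnertonDyer.Theorems.…` (summit = sub)
set_option autoImplicit false

/-!
# Crux `EisensteinHeartFlatCMInertBadKPrime` (stmt-BirchSwinnertonDyer-21341), line `hsieh-lambda`, layer 2 (V2):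
# hypothesis (P) of `…KatzHsiehDisplay.display_relation` at the crux's data — a CM curve with bad reduction at `p`
# is additive there, so `p ∣ N_W` and the newform of `W` has `a_p(f) = 0`

Route `BiquadraticEisensteinDescent` (cell `pub/bsd-wall`, width seat `bsd-wall-cm-bed-w3`). The display file
`…KatzHsiehDisplay.lean` takes `(hpN : p ∣ N) (hap : cuspCoeff f p = 0)` — needed to read Hsieh's Euler polynomial at
`𝔭` as `1` and to expose the Steinberg power `pⁿ` (`hsiehInterpolationValue_of_dvd`). At the crux's data
(`W.HasCM`, `¬ Good W p`, `IsNewformOf W f`, level `N = N_W`) both hold: a CM curve has no multiplicative prime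
(`Rank1Residual.not_mult_of_hasCM`, Silverman *Advanced Topics* II.6.4), so a bad prime is additive (trichotomy of
the `ℤ_p`-minimal model), the additive local factor is `1` (`lFunction_apply_eq_zero_of_hasAdditiveReductionAt`,
*AEC* C.16) and `a_p(f) = a_p(W)` for the newform of `W` (`IsNewformOf`). THEOREMS ONLY (no definition, no named
fact, no `sorry`); supports stmt-BirchSwinnertonDyer-21341 as a helper; nothing about the crux is asserted.

References: [SilvermanATAEC1994] Thm. II.6.4; [SilvermanAEC2009] VII.5 Prop. 5.1, App. C §16; [DiamondShurman2005]
Thm. 8.8.1 / Def. 8.8.2 (`a_n(f) = a_n(E)`).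
-/

noncomputable section

open scoped MatrixGroups
open NumberField IsDedekindDomain Rat.HeightOneSpectrum WeierstrassCurve CongruenceSubgroup
open Literature.NumberTheory.EllipticCurves Literature.NumberTheory.EllipticCurves.ModularForms
open Literature.NumberTheory.EllipticCurves.Rank1Residual

namespace Summit.BirchSwinnertonDyer.BirchSwinnertonDyer.Theorems.BiquadraticEisensteinDescentEisensteinHeartFlatCMInertBadKPrimeCuspCoeffVanishing

variable {W : WeierstrassCurve ℚ} [W.IsElliptic] {p : ℕ} [Fact p.Prime]

/-- **A CM curve with bad reduction at `p` has additive reduction there** (`ℤ_p`-minimal model): the reduction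
is good, multiplicative or additive; it is not good by hypothesis and not multiplicative because `j(W) ∈ ℤ`
(`not_mult_of_hasCM`). [cite: SilvermanATAEC1994, Thm. II.6.4 (PDF p. 148)] [cite: SilvermanAEC2009, VII.5 Prop. 5.1] -/
theorem hasAdditiveReduction_padic_of_hasCM_of_not_good (hCM : W.HasCM) (hbad : ¬ Good W p) :
    ((W.baseChange ℚ_[p]).minimal ℤ_[p]).HasAdditiveReduction ℤ_[p] := by
  rcases hasGoodReduction_or_hasMultiplicativeReduction_or_hasAdditiveReduction ℤ_[p]
      (W := (W.baseChange ℚ_[p]).minimal ℤ_[p]) with h | h | h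
  · exact absurd h hbad
  · exact absurd h (not_mult_of_hasCM W hCM p)
  · exact h

/-- At the place `v` of `𝓞 ℚ` over `p`, the same curve has additive reduction in the sense of
`HasAdditiveReductionAt` (the `v`/`p` bridge `hasAdditiveReduction_padic_iff_hasAdditiveReductionAt_ringOfIntegers`).
[cite: SilvermanAEC2009, VII.5 Prop. 5.1 and VII.1 Prop. 1.3(b)] -/
theorem hasAdditiveReductionAt_of_hasCM_of_not_good (hCM : W.HasCM) (v : HeightOneSpectrum (𝓞 ℚ))
    (hv : (primesEquiv v : ℕ) = p) (hbad : ¬ Good W p) : W.HasAdditiveReductionAt v := by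
  subst hv
  exact (W.hasAdditiveReduction_padic_iff_hasAdditiveReductionAt_ringOfIntegers v).mp
    (hasAdditiveReduction_padic_of_hasCM_of_not_good hCM hbad)

/-- **`a_p(W) = 0` for a CM curve with bad reduction at `p`** (Mathlib's `WeierstrassCurve.LFunction`): the local
factor at an additive place is `1`. [cite: SilvermanAEC2009, App. C §16 (definition of `L_v(T)`)] -/
theorem lFunction_apply_eq_zero_of_hasCM_of_not_good (hCM : W.HasCM) (hbad : ¬ Good W p) :
    W.LFunction p = 0 := by
  obtain ⟨v, hv⟩ : ∃ v : HeightOneSpectrum (𝓞 ℚ), (primesEquiv v : ℕ) = p :=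
    ⟨primesEquiv.symm ⟨p, Fact.out⟩, by rw [Equiv.apply_symm_apply]⟩
  have h := lFunction_apply_eq_zero_of_hasAdditiveReductionAt v W
    (hasAdditiveReductionAt_of_hasCM_of_not_good hCM v hv hbad)
  rwa [hv] at h

/-- **Hypothesis (P) of `display_relation` at the crux's data**: for `W` CM with bad reduction at `p` and `f` the
newform of `W` (`IsNewformOf W f`: `a_n(f) = a_n(W)`), `cuspCoeff f p = 0`.
[cite: DiamondShurman2005, Thm. 8.8.1 / Def. 8.8.2] [cite: SilvermanAEC2009, App. C §16] -/
theorem cuspCoeff_eq_zero_of_hasCM_of_not_good (hCM : W.HasCM) (hbad : ¬ Good W p) {N : ℕ} [NeZero N]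
    {f : CuspForm (Gamma0 N) 2} (hf : IsNewformOf W f) : cuspCoeff f p = 0 := by
  rw [hf.2 p, lFunction_apply_eq_zero_of_hasCM_of_not_good hCM hbad, Int.cast_zero]

/-- **Hypothesis (P), level part**: `p ∣ N_W` for a prime of bad reduction (`dvd_conductorNorm_iff_not_hasGoodReductionAtPrime`).
[cite: DiamondShurman2005, §8.3 (PDF p. 353)] -/
theorem dvd_conductorNorm_of_not_good (hbad : ¬ Good W p) : p ∣ W.conductorNorm ℤ :=
  (W.dvd_conductorNorm_iff_not_hasGoodReductionAtPrime p).mpr hbad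

end Summit.BirchSwinnertonDyer.BirchSwinnertonDyer.Theorems.BiquadraticEisensteinDescentEisensteinHeartFlatCMInertBadKPrimeCuspCoeffVanishing

end
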